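import Literature.NumberTheory.Transcendental.QuadraticRelationsLogarithms
import Mathlib.Algebra.MvPolynomial.Funext
import Mathlib.RingTheory.MvPolynomial.Tower
import Mathlib.LinearAlgebra.Basis.VectorSpace
import HarnessLib

/-!
# Quadratic relations between logarithms (Roy–Waldschmidt 1997): the Résumé corollary from Théorème 0.2

Sibling proofs file of `QuadraticRelationsLogarithms.lean` (named fact
`Literature.NumberTheory.Transcendental.royWaldschmidt_quadratic_thm_0_2` = Théorème 0.2 of D. Roy –
M. Waldschmidt, *Approximation diophantienne et indépendance algébrique de logarithmes*, Ann. Sci.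
ÉNS (4) 30 (1997) 753–796).

PROVED here: **the quadratic-form statement of the Résumé** (p. 753: "si `log α₁, …, log αₙ`
sont des logarithmes `ℚ`-linéairement indépendants de nombres algébriques qui engendrent un corps
de degré de transcendance `1` sur `ℚ`, alors pour toute forme quadratique non nulle
`Q ∈ ℚ[X₁,…,Xₙ]`, le nombre `Q(log α₁,…,log αₙ)` n'est pas nul") **from Théorème 0.2**, as the
authors indicate it (Théorème 0.2 p. 755; §7 p. 791):
`royWaldschmidt_quadraticForm_ne_zero_of_trdeg_one_of_thm_0_2 (h : royWaldschmidt_quadratic_thm_0_2)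
  (n) (l : Fin n → ℂ) … (Q : MvPolynomial (Fin n) ℚ) … : MvPolynomial.aeval l Q ≠ 0`,
with the corollary SPELLED OUT as the conclusion (hypotheses: `e^{λᵢ}` algebraic, `λ`
`ℚ`-linearly independent, `trdeg_ℚ ℚ(λ₁,…,λₙ) = 1`, `Q` homogeneous of degree `2`, `Q ≠ 0`).  This
theorem IS the tree's form of the Résumé corollary: a consequence of Théorème 0.2 by linear
algebra, it is carried as a proved implication from the named fact `royWaldschmidt_quadratic_thm_0_2`
and not as a named fact of its own (review of the split, D-0026/D-0027: its only possible proof is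
a proof of Théorème 0.2 — the whole paper: Wirsing-type simultaneous approximation in transcendence
degree 1, Waldschmidt's effective linear subgroup theorem [33], Clifford algebras).
The argument is linear algebra: if `λ ∈ W ⊆ V = Z(Q)` with `W` a subspace of `ℂⁿ` defined over
`ℚ` (`ratSpan s`) and the coordinates of `λ` are `ℚ`-linearly independent, then `W = ℂⁿ`
(`ratSpan_eq_top_of_mem_of_linearIndependent`: a proper subspace defined over `ℚ` lies in the
kernel of a non-zero RATIONAL linear form, which would be a non-trivial `ℚ`-linear relation among
`λ₁, …, λₙ`), hence `Q` vanishes on `ℚⁿ ⊆ ℂⁿ` and is the zero polynomial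
(`eq_zero_of_forall_aeval_cast_eq_zero`, `MvPolynomial.funext`); the other alternative of
Théorème 0.2, `trdeg ≥ 2`, contradicts `trdeg = 1`.

Unconditional PROVED cases of the same corollary elsewhere in the tree: `n ≤ 2`
(`RoyWaldschmidt1997.royWaldschmidt_quadraticForm_ne_zero_of_trdeg_one_of_le_two`,
`…BakerProofs.lean`), `n = 3` and `Q` isotropic over `ℚ`
(`RoyWaldschmidt1997.royWaldschmidt_quadraticForm_ne_zero_of_trdeg_one_three_of_isotropic`,
`…IsotropicProofs.lean`), `Q = X₁² − X₀X₂` / `X₀X₃ − X₁X₂` (Brownawell–Waldschmidt,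
`…BWProofs.lean`).

No new definitions or named facts: the embedding `ℚⁿ ↪ ℂⁿ` is written
`fun i => ((v i : ℚ) : ℂ)` as in `ratSpan`.

## References

* [RoyWaldschmidt1997ENS] D. Roy, M. Waldschmidt, *Approximation diophantienne et indépendance
  algébrique de logarithmes*, Ann. Sci. École Norm. Sup. (4) 30 (1997), 753–796 — Résumé p. 753,
  Théorème 0.2 p. 755, proof §7 p. 791 (lit key paper:doi-10-1016-s0012-9593-97-89938-7).
-/

noncomputable section

open Complex

namespace Literature.NumberTheory.Transcendental

section Deduction

variable {n : ℕ}

/-- Rational vectors of the rational span of `s` lie in `ratSpan s` (their casts do).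
[folklore] -/
theorem cast_mem_ratSpan {s : Set (Fin n → ℚ)} {v : Fin n → ℚ}
    (hv : v ∈ Submodule.span ℚ s) : (fun i => ((v i : ℚ) : ℂ)) ∈ ratSpan s := by
  induction hv using Submodule.span_induction with
  | mem x hx => exact Submodule.subset_span ⟨x, hx, rfl⟩
  | zero =>
    have e : (fun i => (((0 : Fin n → ℚ) i : ℚ) : ℂ)) = 0 := by funext i; simp
    rw [e]; exact (ratSpan s).zero_mem
  | add x y _ _ hx hy =>
    have e : (fun i => (((x + y) i : ℚ) : ℂ)) =
        (fun i => ((x i : ℚ) : ℂ)) + fun i => ((y i : ℚ) : ℂ) := by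
      funext i; simp
    rw [e]; exact (ratSpan s).add_mem hx hy
  | smul c x _ hx =>
    have e : (fun i => (((c • x) i : ℚ) : ℂ)) = (c : ℂ) • fun i => ((x i : ℚ) : ℂ) := by
      funext i; simp
    rw [e]; exact (ratSpan s).smul_mem _ hx

/-- **If a subspace of `ℂⁿ` defined over `ℚ` contains a point with `ℚ`-linearly independent
coordinates, the rational span of its defining vectors is all of `ℚⁿ`**: otherwise that span
lies in the kernel of a non-zero rational linear form `∑ aᵢ Xᵢ`, whose complexification
vanishes on `ratSpan s ∋ l`, giving the non-trivial relation `∑ aᵢ lᵢ = 0`. [folklore] -/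
theorem span_eq_top_of_mem_ratSpan_of_linearIndependent {s : Set (Fin n → ℚ)} {l : Fin n → ℂ}
    (hl : l ∈ ratSpan s) (hli : LinearIndependent ℚ l) : Submodule.span ℚ s = ⊤ := by
  classical
  by_contra hne
  obtain ⟨f, hf0, hker⟩ :=
    Submodule.exists_le_ker_of_lt_top _ (lt_top_iff_ne_top.mpr hne)
  -- coefficients of `f` in the standard basis
  set a : Fin n → ℚ := fun i => f fun j => if i = j then 1 else 0 with ha
  have hf : ∀ v : Fin n → ℚ, f v = ∑ i, v i * a i := fun v => by
    rw [LinearMap.pi_apply_eq_sum_univ f v]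
    simp [a]
  -- the complexified form `F z = ∑ aᵢ zᵢ`
  let F : (Fin n → ℂ) →ₗ[ℂ] ℂ := ∑ i, (a i : ℂ) • LinearMap.proj i
  have hF : ∀ z : Fin n → ℂ, F z = ∑ i, (a i : ℂ) * z i := fun z => by
    simp [F, LinearMap.sum_apply]
  -- `F` vanishes on `ratSpan s`
  have hFs : ratSpan s ≤ LinearMap.ker F := by
    refine Submodule.span_le.mpr ?_
    rintro _ ⟨v, hv, rfl⟩
    have hfv : f v = 0 := hker (Submodule.subset_span hv)
    rw [hf] at hfv
    rw [SetLike.mem_coe, LinearMap.mem_ker, hF]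
    have : (((∑ i, v i * a i : ℚ)) : ℂ) = 0 := by rw [hfv]; simp
    simpa [mul_comm] using this
  -- hence `∑ aᵢ lᵢ = 0`, so `a = 0` by linear independence, so `f = 0`
  have hFl : ∑ i, (a i : ℂ) * l i = 0 := by rw [← hF]; exact hFs hl
  have ha0 : ∀ i, a i = 0 := by
    refine Fintype.linearIndependent_iff.mp hli a ?_
    simpa [Rat.smul_def] using hFl
  refine hf0 (LinearMap.ext fun v => ?_)
  rw [hf]
  simp [ha0]

/-- **A subspace of `ℂⁿ` defined over `ℚ` through a point with `ℚ`-linearly independent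
coordinates is `ℂⁿ`** (the linear-algebra step of the deduction Résumé ⇐ Théorème 0.2).
[folklore] -/
theorem ratSpan_eq_top_of_mem_of_linearIndependent {s : Set (Fin n → ℚ)} {l : Fin n → ℂ}
    (hl : l ∈ ratSpan s) (hli : LinearIndependent ℚ l) : ratSpan s = ⊤ := by
  classical
  have hspan := span_eq_top_of_mem_ratSpan_of_linearIndependent hl hli
  refine eq_top_iff.mpr fun z _ => ?_
  rw [pi_eq_sum_univ z]
  refine Submodule.sum_mem _ fun i _ => Submodule.smul_mem _ _ ?_
  have hmem : (fun j => (((fun k : Fin n => if i = k then (1 : ℚ) else 0) j : ℚ) : ℂ)) ∈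
      ratSpan s :=
    cast_mem_ratSpan (by rw [hspan]; exact Submodule.mem_top)
  convert hmem using 1
  funext j
  by_cases h : i = j <;> simp [h]

/-- A polynomial over `ℚ` vanishing at every rational point of `ℂⁿ` is zero (`ℚ` is infinite:
`MvPolynomial.funext`). [folklore] -/
theorem eq_zero_of_forall_aeval_cast_eq_zero {Q : MvPolynomial (Fin n) ℚ}
    (h : ∀ w : Fin n → ℚ, MvPolynomial.aeval (fun i => ((w i : ℚ) : ℂ)) Q = 0) : Q = 0 := by
  refine MvPolynomial.funext fun w => ?_
  have hw := h w
  have e : (fun i => ((w i : ℚ) : ℂ)) = algebraMap ℚ ℂ ∘ w := by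
    funext i; simp
  rw [e, MvPolynomial.aeval_algebraMap_eq_zero_iff_of_injective (B := ℂ)
    (algebraMap ℚ ℂ).injective] at hw
  simpa using hw

/-- **Roy–Waldschmidt 1997, the quadratic-form corollary of the Résumé/Abstract, from
Théorème 0.2 (the printed deduction, PROVED).**  "Si `log α₁, …, log αₙ` sont des logarithmes
`ℚ`-linéairement indépendants de nombres algébriques qui engendrent un corps de degré de
transcendance `1` sur `ℚ`, alors pour toute forme quadratique non nulle `Q ∈ ℚ[X₁,…,Xₙ]`, le
nombre `Q(log α₁,…,log αₙ)` n'est pas nul": if `λ : Fin n → ℂ` has `ℚ`-linearly independent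
coordinates with `e^{λᵢ}` algebraic and `trdeg_ℚ ℚ(λ₁, …, λₙ) = 1`, and `Q ∈ ℚ[X₁, …, Xₙ]` is
homogeneous of degree `2` and non-zero, then `Q(λ) ≠ 0` — from Théorème 0.2
(`h : royWaldschmidt_quadratic_thm_0_2`, the tree's named fact) with `k = 2`: the alternative
`trdeg ≥ 2` contradicts `trdeg = 1`, and a subspace defined over `ℚ` containing `λ` is `ℂⁿ`
(`ratSpan_eq_top_of_mem_of_linearIndependent`), on which `Q ≠ 0` cannot vanish identically
(`eq_zero_of_forall_aeval_cast_eq_zero`).  This is the tree's (conditional) form of the Résumé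
corollary; it is not a separate named fact.
[cite: RoyWaldschmidt1997ENS, Résumé p. 753 with Théorème 0.2 p. 755] -/
theorem royWaldschmidt_quadraticForm_ne_zero_of_trdeg_one_of_thm_0_2
    (h : royWaldschmidt_quadratic_thm_0_2) (n : ℕ) (l : Fin n → ℂ)
    (hl : ∀ i, IsAlgebraic ℚ (cexp (l i))) (hli : LinearIndependent ℚ l)
    (htr : Algebra.trdeg ℚ ↥(IntermediateField.adjoin ℚ (Set.range l)) = 1)
    (Q : MvPolynomial (Fin n) ℚ) (hQ : Q.IsHomogeneous 2) (hQ0 : Q ≠ 0) :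
    MvPolynomial.aeval l Q ≠ 0 := by
  intro hQl
  rcases h n 2 Q le_rfl hQ l hl hQl with ⟨s, hls, hV⟩ | h2
  · have htop := ratSpan_eq_top_of_mem_of_linearIndependent hls hli
    refine hQ0 (eq_zero_of_forall_aeval_cast_eq_zero fun w => hV _ ?_)
    rw [htop]
    exact Submodule.mem_top
  · rw [htr] at h2
    exact absurd h2 (by norm_num)

end Deduction

end Literature.NumberTheory.Transcendental

end
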